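import Summits.Ventures.GridStability.Models.StructurePreservingInstance
import Literature.MathematicalPhysics.PowerSystems.LosslessMultimachineRegionOfAttraction
import HarnessLib

/-!
# GridStability/Lyapunov/StructurePreservingPolytopeLevel — rational lower bounds for Vu–Turitsyn's
# per-edge level `b_e·vtGap(σ*_e)` at half-angle-tangent equilibria, and the edge-list reduction

Cell `gridfusion` (LADDER-GRIDFUSION), seat gridfusion-lyap-1 (g6); brief «SP-POLYTOPE» (lead RULING
6i (5), repaired on INBOX 2026-08-27). Companion of `Lyapunov/StructurePreservingPolytope{,Unique,Roa}`
(the structure-preserving energy route on Vu–Turitsyn's polytope, level hypothesis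
`∀ i j, bᵢⱼ ≠ 0 → c < bᵢⱼ·vtGap(δ₀ᵢ − δ₀ⱼ)` with the Literature gap
`vtGap d = 2 cos d − (π − 2|d|)·sin|d|` [cite: VuTuritsyn2016, Appendix 9.3]) and the analogue, for
that route, of `StructurePreservingLevelBound.lean` (p479424) for the window route: an instance file
(model-2's `Models/NE39SP.lean`: couplings `b = symmetrize (edgeWeight src tgt wt)` from an indexed
edge list, equilibrium `δ₀ = halfAngle t`, `δ₀ᵢ = 2·arctan tᵢ` with RATIONAL `tᵢ`) must choose a
RATIONAL `c` in the kernel, so it needs (i) a rational lower bound of `vtGap` at a line angle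
`d = 2·arctan a − 2·arctan b` and (ii) the reduction of the all-coupled-pairs hypothesis to `m`
per-edge checks. This file supplies, with no instance data:

* `vtGap_neg` (the gap is even), `vtGap_ge_of_abs_le_pi` — for `|d| ≤ π`:
  `2 cos d − (π − 2|sin d|)·|sin d| ≤ vtGap d` (`sin|d| = |sin d|` there and `|sin d| ≤ |d|`,
  Mathlib `Real.abs_sin_le_abs`; the gap is DECREASING in `|d|`, so under-estimating `|d|` by
  `|sin d|` under-estimates the gap), and `vtGap_ge_d6` — the trig-argument-free form
  `2 cos d − (3.141593 − 2|sin d|)·|sin d| ≤ vtGap d` (Mathlib `Real.pi_lt_d6`);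
* `cos_halfAngle_sub`, `sin_halfAngle_sub'` — for `tᵢtⱼ > −1` the line angle is `2·arctan q`,
  `q = (tᵢ − tⱼ)/(1 + tᵢtⱼ)` (model-2's `two_mul_arctan_sub`), so `cos` and `sin` of it are the
  RATIONAL functions `(1 − q²)/(1 + q²)`, `2q/(1 + q²)` (g3's `cos_two_mul_arctan`,
  `sin_two_mul_arctan`); `ratGap q` — the resulting rational lower bound
  `2(1 − q²)/(1 + q²) − (3.141593 − 4|q|/(1 + q²))·2|q|/(1 + q²)` and `ratGap_le_vtGap`;
* `level_of_edgeChecks` — **per-edge checks suffice**: if every LISTED edge `e` has `wt e ≥ 0`,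
  `t_src·t_tgt > −1`, `0 ≤ ratGap q_e` and `c < wt e · ratGap q_e`, then EVERY coupled pair of
  `b = symmetrize (edgeWeight src tgt wt)` satisfies `c < bᵢⱼ·vtGap(δ₀ᵢ − δ₀ⱼ)` at `δ₀ = halfAngle t`
  (a nonzero coupling is witnessed by a listed edge in one orientation, model-2's
  `exists_edge_of_symmetrize_ne_zero`; `bᵢⱼ ≥ wt e`; evenness of the gap).

Pure real analysis and bookkeeping (MODELLED/CERTIFIED columns untouched); one definition (`ratGap`,
an explicit rational function, bookkeeping for the instance's `decide`); no named fact; standard axioms.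
-/

noncomputable section

open Real Finset
open Summit.Ventures.GridStability.Models.StructurePreserving
open Literature.MathematicalPhysics.PowerSystems.ClassicalModel.LosslessSystem (vtGap)

namespace Summit.Ventures.GridStability.Lyapunov.StructurePreserving

variable {n m : ℕ}

/-! ### Rational lower bounds for the gap -/

/-- The gap is even: a line read in the opposite orientation has the same gap. [folklore] -/
theorem vtGap_neg (d : ℝ) : vtGap (-d) = vtGap d := by
  unfold vtGap
  rw [Real.cos_neg, abs_neg]

/-- **Trig lower bound of the gap**: for `|d| ≤ π`,
`2 cos d − (π − 2|sin d|)·|sin d| ≤ vtGap d = 2 cos d − (π − 2|d|)·sin|d|`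
(`sin|d| = |sin d| ≥ 0` and `|sin d| ≤ |d|`). [folklore] -/
theorem vtGap_ge_of_abs_le_pi {d : ℝ} (hd : |d| ≤ π) :
    2 * Real.cos d - (π - 2 * |Real.sin d|) * |Real.sin d| ≤ vtGap d := by
  -- `sin |d| = |sin d|` for `|d| ≤ π` (as in `WSCC9LossySlab.sin_abs_eq_abs_sin`, inlined)
  have hsa : Real.sin |d| = |Real.sin d| := by
    rcases le_or_gt 0 d with h | h
    · rw [abs_of_nonneg h]
      have hs : 0 ≤ Real.sin d :=
        Real.sin_nonneg_of_nonneg_of_le_pi h (by rwa [abs_of_nonneg h] at hd)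
      rw [abs_of_nonneg hs]
    · rw [abs_of_neg h, Real.sin_neg]
      have hd' : -π ≤ d := by
        rw [abs_of_neg h] at hd
        linarith
      have hs : Real.sin d ≤ 0 := Real.sin_nonpos_of_nonpos_of_neg_pi_le h.le hd'
      rw [abs_of_nonpos hs]
  unfold vtGap
  rw [hsa]
  have h1 : |Real.sin d| ≤ |d| := Real.abs_sin_le_abs
  have h2 : 0 ≤ |Real.sin d| := abs_nonneg _
  nlinarith

/-- **Trig-argument-free lower bound of the gap**: for `|d| ≤ π`,
`2 cos d − (3.141593 − 2|sin d|)·|sin d| ≤ vtGap d` (Mathlib `Real.pi_lt_d6 : π < 3.141593`).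
[folklore] -/
theorem vtGap_ge_d6 {d : ℝ} (hd : |d| ≤ π) :
    2 * Real.cos d - (3.141593 - 2 * |Real.sin d|) * |Real.sin d| ≤ vtGap d := by
  have h := vtGap_ge_of_abs_le_pi hd
  have hπ := Real.pi_lt_d6
  have h2 : 0 ≤ |Real.sin d| := abs_nonneg _
  nlinarith

/-! ### Half-angle-tangent line angles: `cos` and `sin` are rational -/

/-- The half-angle-tangent quotient of a line: `q = (a − b)/(1 + ab)` (`tan` of half the line angle
for `δᵢ = 2·arctan a`, `δⱼ = 2·arctan b`, `ab > −1`). -/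
def hq (a b : ℝ) : ℝ := (a - b) / (1 + a * b)

/-- `cos(2·arctan a − 2·arctan b) = (1 − q²)/(1 + q²)` for `ab > −1`. [folklore] -/
theorem cos_halfAngle_sub {a b : ℝ} (hab : -1 < a * b) :
    Real.cos (2 * Real.arctan a - 2 * Real.arctan b) = (1 - hq a b ^ 2) / (1 + hq a b ^ 2) := by
  rw [two_mul_arctan_sub hab, cos_two_mul_arctan]
  rfl

/-- `sin(2·arctan a − 2·arctan b) = 2q/(1 + q²)` for `ab > −1`. [folklore] -/
theorem sin_halfAngle_sub' {a b : ℝ} (hab : -1 < a * b) :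
    Real.sin (2 * Real.arctan a - 2 * Real.arctan b) = 2 * hq a b / (1 + hq a b ^ 2) := by
  rw [two_mul_arctan_sub hab, sin_two_mul_arctan]
  rfl

/-- A half-angle line angle lies in `(−π, π)` (it is `2·arctan q`). [folklore] -/
theorem abs_halfAngle_sub_lt_pi {a b : ℝ} (hab : -1 < a * b) :
    |2 * Real.arctan a - 2 * Real.arctan b| < π := by
  rw [two_mul_arctan_sub hab]
  have h1 := Real.arctan_lt_pi_div_two ((a - b) / (1 + a * b))
  have h2 := Real.neg_pi_div_two_lt_arctan ((a - b) / (1 + a * b))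
  rw [abs_lt]
  constructor <;> [linarith; linarith]

/-- **The rational gap bound** at half-angle-tangent quotient `q`:
`ratGap q = 2(1 − q²)/(1 + q²) − (3.141593 − 2·|2q/(1 + q²)|)·|2q/(1 + q²)|` — a rational function of
`q` (bookkeeping for an instance's `decide`). -/
def ratGap {K : Type*} [Field K] [LinearOrder K] (q : K) : K :=
  2 * ((1 - q ^ 2) / (1 + q ^ 2))
    - (3141593 / 1000000 - 2 * |2 * q / (1 + q ^ 2)|) * |2 * q / (1 + q ^ 2)|

/-- The rational gap bound commutes with the cast `ℚ → ℝ`. [folklore] -/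
theorem ratGap_ratCast (q : ℚ) : ((ratGap q : ℚ) : ℝ) = ratGap (q : ℝ) := by
  unfold ratGap
  push_cast
  rfl

/-- **`ratGap q ≤ vtGap(2·arctan a − 2·arctan b)`** for `q = (a − b)/(1 + ab)`, `ab > −1`: the kernel
inequality an instance checks over `ℚ`. [cite: VuTuritsyn2016, Appendix 9.3 (analytical approximation of V_min)] -/
theorem ratGap_le_vtGap {a b : ℝ} (hab : -1 < a * b) :
    ratGap (hq a b) ≤ vtGap (2 * Real.arctan a - 2 * Real.arctan b) := by
  have h := vtGap_ge_d6 (abs_halfAngle_sub_lt_pi hab).le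
  rw [cos_halfAngle_sub hab, sin_halfAngle_sub' hab] at h
  unfold ratGap
  norm_num at h ⊢
  exact h

/-! ### Per-edge checks suffice (edge-list data, half-angle equilibria) -/

variable {src tgt : Fin m → Fin n} {wt : Fin m → ℝ}

/-- **Per-edge level checks suffice.** For couplings `b = symmetrize (edgeWeight src tgt wt)` from an
indexed edge list with `wt ≥ 0`, half-angle data `t` with `t_src·t_tgt > −1` on every listed edge, and
a level `c` with `0 ≤ ratGap q_e` and `c < wt e · ratGap q_e` on every listed edge
(`q_e = (t_src − t_tgt)/(1 + t_src t_tgt)`): EVERY coupled pair satisfies the polytope-route level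
hypothesis `c < bᵢⱼ · vtGap(δ₀ᵢ − δ₀ⱼ)` at `δ₀ = halfAngle t` (a nonzero coupling is witnessed by a listed
edge, `bᵢⱼ ≥ wt e ≥ 0`, `vtGap ≥ ratGap ≥ 0`, evenness of the gap for the reversed orientation).
[folklore] -/
theorem level_of_edgeChecks {t : Fin n → ℝ} (hwt : ∀ e, 0 ≤ wt e)
    (hprod : ∀ e, -1 < t (src e) * t (tgt e))
    (hR0 : ∀ e, 0 ≤ ratGap (hq (t (src e)) (t (tgt e)))) {c : ℝ}
    (hc : ∀ e, c < wt e * ratGap (hq (t (src e)) (t (tgt e)))) {i j : Fin n}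
    (hne : symmetrize (edgeWeight src tgt wt) i j ≠ 0) :
    c < symmetrize (edgeWeight src tgt wt) i j * vtGap (halfAngle t i - halfAngle t j) := by
  obtain ⟨e, ⟨hs, ht⟩ | ⟨hs, ht⟩⟩ := exists_edge_of_symmetrize_ne_zero hne
  · subst hs; subst ht
    have hb : wt e ≤ symmetrize (edgeWeight src tgt wt) (src e) (tgt e) :=
      (le_edgeWeight_of_edge hwt e rfl rfl).trans (le_symmetrize_left (edgeWeight_nonneg hwt) _ _)
    have hgap : ratGap (hq (t (src e)) (t (tgt e))) ≤ vtGap (halfAngle t (src e) - halfAngle t (tgt e)) :=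
      ratGap_le_vtGap (hprod e)
    calc c < wt e * ratGap (hq (t (src e)) (t (tgt e))) := hc e
      _ ≤ symmetrize (edgeWeight src tgt wt) (src e) (tgt e) * ratGap (hq (t (src e)) (t (tgt e))) :=
          mul_le_mul_of_nonneg_right hb (hR0 e)
      _ ≤ symmetrize (edgeWeight src tgt wt) (src e) (tgt e)
            * vtGap (halfAngle t (src e) - halfAngle t (tgt e)) :=
          mul_le_mul_of_nonneg_left hgap ((hwt e).trans hb)
  · subst hs; subst ht
    have hb : wt e ≤ symmetrize (edgeWeight src tgt wt) (tgt e) (src e) :=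
      (le_edgeWeight_of_edge hwt e rfl rfl).trans (le_symmetrize_right (edgeWeight_nonneg hwt) _ _)
    have hgap : ratGap (hq (t (src e)) (t (tgt e))) ≤ vtGap (halfAngle t (tgt e) - halfAngle t (src e)) := by
      rw [show halfAngle t (tgt e) - halfAngle t (src e) = -(halfAngle t (src e) - halfAngle t (tgt e))
        by ring, vtGap_neg]
      exact ratGap_le_vtGap (hprod e)
    calc c < wt e * ratGap (hq (t (src e)) (t (tgt e))) := hc e
      _ ≤ symmetrize (edgeWeight src tgt wt) (tgt e) (src e) * ratGap (hq (t (src e)) (t (tgt e))) :=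
          mul_le_mul_of_nonneg_right hb (hR0 e)
      _ ≤ symmetrize (edgeWeight src tgt wt) (tgt e) (src e)
            * vtGap (halfAngle t (tgt e) - halfAngle t (src e)) :=
          mul_le_mul_of_nonneg_left hgap ((hwt e).trans hb)

end Summit.Ventures.GridStability.Lyapunov.StructurePreserving

end
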